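import Literature.NumberTheory.EllipticCurves.ModularDegreeFormulaDomainProofs
import Literature.NumberTheory.EllipticCurves.HeckeOperatorsPeterssonProofs
import Literature.NumberTheory.EllipticCurves.HalfIntegralWeightFormsThetaMultiplierProofs
import Mathlib.MeasureTheory.Group.FundamentalDomain
import HarnessLib

/-!
# `⋃_q g_q⁻¹ 𝒟ᵒ` is a fundamental domain for `Γ₀(N)⁺ = Γ₀(N) ∩ Γ₁(4)` in Mathlib's measure-theoretic sense; coset unions

[[cite: DiamondShurman2005, §2.3–2.4, §5.4]] — groundwork for the UNFOLDING step of Shintani's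
theta lift (route to `tunnell_converse_even`, file `ShintaniLift`): the tree's domain
`F = ⋃_q {τ | g_q τ ∈ 𝒟ᵒ}` of `Γ₀(N)` (`ModularDegreeFormulaDomainProofs`: pairwise disjoint pieces,
one point per orbit, a.e. every orbit meets `F`) is packaged as a Mathlib
`MeasureTheory.IsFundamentalDomain`, so that Mathlib's API (`integral_eq_tsum`, `setIntegral_eq`
for two fundamental domains of the same group, …) becomes available for the orbit decomposition
`∫_F ∑_{γ ∈ Γ_x∖Γ} = ∫_{Γ_x∖ℍ}`.  Since `-1` acts trivially, `Γ₀(N)` itself has no fundamental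
domain in that sense; we use the index-`2` subgroup **`Γ₀(N)⁺ := Γ₀(N) ∩ Γ₁(4)`** (`d ≡ 1 mod 4`,
`4 ∣ N`), which misses `-1` and has the same orbits (`mem_Gamma0Plus_or_neg_mem`).  We PROVE:

* the (discrete) measurable structure on `SL(2, ℤ)` and its subgroups, `MeasurableSMul` and
  `SMulInvariantMeasure` on `ℍ` (from Mathlib's invariance of the hyperbolic measure under
  `GL(2, ℝ)`);
* `smul_gamma0Domain_disjoint` — `γ • F ∩ F = ∅` for `γ ∈ Γ₀(N)⁺ ∖ {1}` (Serre's
  `eq_one_or_neg_one_of_mem_fdo_mem_fdo` through the tree's `eq_of_smul_eq_of_mem_fdo`);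
* **`isFundamentalDomain_gamma0Domain : IsFundamentalDomain (Γ₀(N)⁺) F volume`** (`4 ∣ N`);
* `isFundamentalDomain_iUnion_smul` — for ANY group: if `s` is a fundamental domain for `G`,
  `H ≤ G` and `R` a system of representatives (`∀ g, ∃ r ∈ R, r g ∈ H`, unique modulo `H`), then
  `⋃_{r ∈ R} r • s` is a fundamental domain for `H`;
* `setIntegral_iUnion_smul_eq_tsum` — `∫_{⋃_r r•s} f = ∑_r ∫_s f(r • x)` (invariance of `μ`).

No named facts; the definitions are `Gamma0Plus` (an `abbrev` for `Γ₀(N) ⊓ Γ₁(4)`), the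
domain `gamma0Domain g`, and the measurable-structure instances.
-/

noncomputable section

open scoped MatrixGroups ModularForm Modular Topology ENNReal NNReal Pointwise
open MeasureTheory Filter Set Function ModularGroup CongruenceSubgroup
open UpperHalfPlane hiding I

namespace Literature.NumberTheory.EllipticCurves.ModularForms

/-! ### Measurable structure on `SL(2, ℤ)` and its subgroups acting on `ℍ` -/

section Instances

/-- `instMeasurableSpaceSL2Z` (auxiliary). [folklore] -/
instance instMeasurableSpaceSL2Z : MeasurableSpace SL(2, ℤ) := ⊤

/-- `instMeasurableSingletonClassSL2Z` (auxiliary). [folklore] -/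
instance instMeasurableSingletonClassSL2Z : MeasurableSingletonClass SL(2, ℤ) :=
  ⟨fun _ ↦ trivial⟩

/-- `instCountableSL2Z` (auxiliary). [folklore] -/
instance instCountableSL2Z : Countable SL(2, ℤ) := countable_SL2Z

variable (Γ : Subgroup SL(2, ℤ))

/-- `instMeasurableSingletonClassSubgroup` (auxiliary). [folklore] -/
instance instMeasurableSingletonClassSubgroup : MeasurableSingletonClass Γ :=
  ⟨fun _ ↦ MeasurableSet.of_discrete⟩

/-- The action of a subgroup of `SL(2, ℤ)` on `ℍ` is measurable. [folklore] -/
instance instMeasurableSMulSubgroup : MeasurableSMul Γ ℍ where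
  measurable_const_smul c := (continuous_sl2z_smul (c : SL(2, ℤ))).measurable
  measurable_smul_const _ := measurable_of_countable _

/-- The hyperbolic measure is invariant under every subgroup of `SL(2, ℤ)`. [folklore] -/
instance instSMulInvariantMeasureSubgroup : SMulInvariantMeasure Γ ℍ (volume : Measure ℍ) := by
  refine ⟨fun c s hs ↦ ?_⟩
  have h := (measurePreserving_smul
    (Matrix.SpecialLinearGroup.mapGL ℝ (c : SL(2, ℤ)) : GL (Fin 2) ℝ) (volume : Measure ℍ)).measure_preimage
    hs.nullMeasurableSet
  exact h

/-- The action of `SL(2, ℤ)` itself is measurable. [folklore] -/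
instance instMeasurableSMulSL2Z : MeasurableSMul SL(2, ℤ) ℍ where
  measurable_const_smul c := (continuous_sl2z_smul c).measurable
  measurable_smul_const _ := measurable_of_countable _

/-- The hyperbolic measure is `SL(2, ℤ)`-invariant. [folklore] -/
instance instSMulInvariantMeasureSL2Z : SMulInvariantMeasure SL(2, ℤ) ℍ (volume : Measure ℍ) := by
  refine ⟨fun c s hs ↦ ?_⟩
  exact (measurePreserving_smul (Matrix.SpecialLinearGroup.mapGL ℝ c : GL (Fin 2) ℝ)
    (volume : Measure ℍ)).measure_preimage hs.nullMeasurableSet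

end Instances

/-! ### `Γ₀(N)⁺ = Γ₀(N) ∩ Γ₁(4)`: the complement of `-1` -/

section Plus

variable {N : ℕ}

/-- `Γ₀(N)⁺ := Γ₀(N) ∩ Γ₁(4)` (`d ≡ 1 (mod 4)`); for `4 ∣ N` it has index `2` in `Γ₀(N)` and
`Γ₀(N) = Γ₀(N)⁺ ⊔ (-1)Γ₀(N)⁺`, so both groups have the same orbits on `ℍ`, but `Γ₀(N)⁺ ∌ -1` acts
with trivial generic stabilisers. [folklore] -/
abbrev Gamma0Plus (N : ℕ) : Subgroup SL(2, ℤ) := Gamma0 N ⊓ Gamma1 4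

/-- `Γ₀(N)⁺ ≤ Γ₀(N)`. [folklore] -/
theorem Gamma0Plus_le : Gamma0Plus N ≤ Gamma0 N := inf_le_left

/-- `-1 ∉ Γ₀(N)⁺`. [folklore] -/
theorem neg_one_not_mem_Gamma0Plus : (-1 : SL(2, ℤ)) ∉ Gamma0Plus N := by
  intro h
  have h1 : (-1 : SL(2, ℤ)) ∈ Gamma1 4 := h.2
  rw [Gamma1_mem] at h1
  have h2 := h1.2.1
  rw [SL_neg_apply] at h2
  simp only [Matrix.SpecialLinearGroup.coe_one, Matrix.one_apply_eq, Int.cast_neg, Int.cast_one] at h2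
  exact absurd h2 (by decide)

/-- For `4 ∣ N` and `γ ∈ Γ₀(N)`: `γ ∈ Γ₀(N)⁺` or `-γ ∈ Γ₀(N)⁺` (`d` is odd). [folklore] -/
theorem mem_Gamma0Plus_or_neg_mem (h4 : 4 ∣ N) {γ : SL(2, ℤ)} (hγ : γ ∈ Gamma0 N) :
    γ ∈ Gamma0Plus N ∨ -γ ∈ Gamma0Plus N := by
  have hγ4 : γ ∈ Gamma0 4 := mem_Gamma0_four_of_dvd h4 hγ
  have hc : ((γ 1 0 : ℤ) : ZMod 4) = 0 := Gamma0_mem.mp hγ4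
  have hdet : (γ 0 0 : ℤ) * γ 1 1 - γ 0 1 * γ 1 0 = 1 := by
    have := Matrix.det_fin_two (γ : Matrix (Fin 2) (Fin 2) ℤ)
    rw [γ.det_coe] at this
    linarith
  have hdetZ : ((γ 0 0 : ℤ) : ZMod 4) * (γ 1 1 : ℤ) = 1 := by
    have := congrArg (fun t : ℤ ↦ (t : ZMod 4)) hdet
    push_cast at this
    rw [hc, mul_zero, sub_zero] at this
    exact this
  -- `d` is a unit of `ZMod 4`, hence `±1`, and `a = d`
  have hd : ((γ 1 1 : ℤ) : ZMod 4) = 1 ∨ ((γ 1 1 : ℤ) : ZMod 4) = -1 := by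
    have hu : IsUnit (((γ 1 1 : ℤ) : ZMod 4)) := IsUnit.of_mul_eq_one _ ((mul_comm _ _).trans hdetZ)
    revert hu
    generalize ((γ 1 1 : ℤ) : ZMod 4) = x
    decide +revert
  have had : ((γ 0 0 : ℤ) : ZMod 4) = ((γ 1 1 : ℤ) : ZMod 4) := by
    rcases hd with h | h
    · rw [h, mul_one] at hdetZ; rw [hdetZ, h]
    · rw [h, mul_neg, mul_one, neg_eq_iff_eq_neg] at hdetZ; rw [hdetZ, h]
  rcases hd with h | h
  · left
    have h1 : γ ∈ Gamma1 4 := (Gamma1_mem 4 γ).mpr ⟨had.trans h, h, hc⟩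
    exact Subgroup.mem_inf.mpr ⟨hγ, h1⟩
  · right
    have h1 : -γ ∈ Gamma1 4 := by
      refine (Gamma1_mem 4 (-γ)).mpr ?_
      rw [SL_neg_apply, SL_neg_apply, SL_neg_apply]
      push_cast
      rw [had, h, hc]
      refine ⟨by ring, by ring, by ring⟩
    exact Subgroup.mem_inf.mpr ⟨neg_mem_Gamma0 hγ, h1⟩

end Plus

/-! ### The domain `⋃_q g_q⁻¹ 𝒟ᵒ` is a fundamental domain for `Γ₀(N)⁺` -/

section Domain

variable {N : ℕ} [NeZero N]
variable (g : (↥𝒮ℒ ⧸ (Gamma0 N : Subgroup (GL (Fin 2) ℝ)).subgroupOf 𝒮ℒ) → SL(2, ℤ))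
  (hg : ∀ q, (Matrix.SpecialLinearGroup.mapGL ℝ (g q) : GL (Fin 2) ℝ) = ((q.out : ↥𝒮ℒ) : GL (Fin 2) ℝ))

/-- The domain `F = ⋃_q {τ | g_q τ ∈ 𝒟ᵒ} = ⋃_q g_q⁻¹ 𝒟ᵒ`. [cite: DiamondShurman2005, §2.3–2.4] -/
def gamma0Domain : Set ℍ := ⋃ q, {τ : ℍ | g q • τ ∈ 𝒟ᵒ}

omit hg in
/-- The domain is measurable (open). [folklore] -/
theorem measurableSet_gamma0Domain : MeasurableSet (gamma0Domain g) :=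
  MeasurableSet.iUnion fun q ↦ (isOpen_setOf_smul_mem_fdo (g q)).measurableSet

omit [NeZero N] in
include hg in
/-- A non-trivial element of `Γ₀(N)⁺` moves the domain off itself:
`γ • F ∩ F = ∅` for `γ ∈ Γ₀(N)⁺ ∖ {1}`. [folklore] -/
theorem smul_gamma0Domain_disjoint {γ : SL(2, ℤ)} (hγ : γ ∈ Gamma0Plus N) (h1 : γ ≠ 1) :
    Disjoint (γ • gamma0Domain g) (gamma0Domain g) := by
  rw [Set.disjoint_left]
  rintro τ ⟨σ, hσ, rfl⟩ hτ
  simp only [gamma0Domain, mem_iUnion, mem_setOf_eq] at hσ hτ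
  obtain ⟨q, hq⟩ := hσ
  obtain ⟨r, hr⟩ := hτ
  have heq : σ = γ • σ := eq_of_smul_eq_of_mem_fdo g hg hq hr (Gamma0Plus_le hγ) rfl
  -- `g_q γ g_q⁻¹` fixes `g_q σ ∈ 𝒟ᵒ`, hence is `±1`
  have hmove : (g q * γ * (g q)⁻¹) • (g q • σ) ∈ 𝒟ᵒ := by
    rw [mul_smul, mul_smul, inv_smul_smul, ← heq]; exact hq
  rcases eq_one_or_neg_one_of_mem_fdo_mem_fdo hq hmove with h | h
  · apply h1
    have : g q * γ = g q := by
      have := congrArg (· * g q) h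
      simpa using this
    exact mul_left_cancel (this.trans (mul_one _).symm)
  · apply neg_one_not_mem_Gamma0Plus (N := N)
    have : γ = -1 := by
      have h' := congrArg (fun t ↦ (g q)⁻¹ * t * g q) h
      simp [mul_assoc] at h'
      simpa [mul_assoc] using h'
    rwa [this] at hγ

include hg in
/-- **`F = ⋃_q g_q⁻¹ 𝒟ᵒ` is a fundamental domain for `Γ₀(N)⁺` acting on `ℍ`** (`4 ∣ N`), in
Mathlib's measure-theoretic sense. [cite: DiamondShurman2005, §2.3–2.4] -/
theorem isFundamentalDomain_gamma0Domain (h4 : 4 ∣ N) :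
    IsFundamentalDomain (Gamma0Plus N) (gamma0Domain g) (volume : Measure ℍ) where
  nullMeasurableSet := (measurableSet_gamma0Domain g).nullMeasurableSet
  ae_covers := by
    have hnull := volume_setOf_exists_smul_mem_fd_diff_fdo
    rw [Filter.Eventually, mem_ae_iff]
    refine measure_mono_null (fun τ hτ ↦ ?_) hnull
    simp only [mem_compl_iff, mem_setOf_eq, not_exists] at hτ
    by_contra hcon
    simp only [mem_setOf_eq, not_exists] at hcon
    have hτ' : ∀ s : SL(2, ℤ), s • τ ∈ 𝒟 → s • τ ∈ 𝒟ᵒ := fun s hs ↦ by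
      by_contra hso; exact hcon s ⟨hs, hso⟩
    obtain ⟨γ, hγ, q, hq⟩ := exists_smul_mem_smul_fdo g hg hτ'
    rcases mem_Gamma0Plus_or_neg_mem h4 hγ with hp | hp
    · exact hτ ⟨γ, hp⟩ (mem_iUnion.mpr ⟨q, by simpa using hq⟩)
    · refine hτ ⟨-γ, hp⟩ (mem_iUnion.mpr ⟨q, ?_⟩)
      simp only [mem_setOf_eq]
      have : ((⟨-γ, hp⟩ : Gamma0Plus N) • τ : ℍ) = γ • τ := by
        show (-γ) • τ = γ • τ
        exact SL_neg_smul γ τ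
      rw [this]; exact hq
  aedisjoint := by
    intro a b hab
    have hne : (a⁻¹ * b : Gamma0Plus N) ≠ 1 := by
      intro h; apply hab; rw [inv_mul_eq_one] at h; exact h
    have hne' : ((a⁻¹ * b : Gamma0Plus N) : SL(2, ℤ)) ≠ 1 := by
      intro h; apply hne; exact_mod_cast h
    have hdis := smul_gamma0Domain_disjoint g hg (a⁻¹ * b).2 hne'
    refine Disjoint.aedisjoint ?_
    change Disjoint (a • gamma0Domain g) (b • gamma0Domain g)
    rw [Set.disjoint_left] at hdis ⊢
    rintro x ⟨σ, hσ, rfl⟩ ⟨σ', hσ', hx⟩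
    -- `σ = (a⁻¹ b) • σ'` lies in `F ∩ (a⁻¹ b) • F`
    refine hdis ⟨σ', hσ', ?_⟩ hσ
    have hx' : (b : SL(2, ℤ)) • σ' = (a : SL(2, ℤ)) • σ := hx
    show (((a⁻¹ * b : Gamma0Plus N)) : SL(2, ℤ)) • σ' = σ
    rw [Subgroup.coe_mul, Subgroup.coe_inv, mul_smul, hx', inv_smul_smul]

end Domain

/-! ### Fundamental domains for subgroups: unions over coset representatives -/

section Cosets

variable {G α E : Type*} [Group G] [MulAction G α] [MeasurableSpace α] {μ : Measure α} {s : Set α}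
  [MeasurableSpace G] [MeasurableSMul G α] [SMulInvariantMeasure G α μ] [Countable G]

/-- **Coset unions**: if `s` is a fundamental domain for `G` and `R ⊆ G` is a system of
representatives with `G = ⋃_{r ∈ R} r⁻¹ H` (every `g` has some `r ∈ R` with `r g ∈ H`, unique in the
sense `r' r⁻¹ ∈ H → r = r'`), then `⋃_{r ∈ R} r • s` is a fundamental domain for the subgroup `H`.
[folklore] -/
theorem isFundamentalDomain_iUnion_smul (hs : IsFundamentalDomain G s μ) (H : Subgroup G)
    (R : Set G) (hcov : ∀ g : G, ∃ r ∈ R, r * g ∈ H)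
    (huniq : ∀ r ∈ R, ∀ r' ∈ R, r' * r⁻¹ ∈ H → r = r') :
    IsFundamentalDomain H (⋃ r ∈ R, r • s) μ where
  nullMeasurableSet := by
    haveI : Countable R := Subtype.countable
    rw [biUnion_eq_iUnion]
    exact NullMeasurableSet.iUnion fun r ↦ hs.nullMeasurableSet.smul _
  ae_covers := by
    filter_upwards [hs.ae_covers] with x ⟨g, hg⟩
    obtain ⟨r, hr, hrg⟩ := hcov g
    refine ⟨⟨r * g, hrg⟩, mem_iUnion₂.mpr ⟨r, hr, ?_⟩⟩
    refine ⟨g • x, hg, ?_⟩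
    show r • g • x = (⟨r * g, hrg⟩ : H) • x
    rw [← mul_smul]; rfl
  aedisjoint := by
    haveI : Countable R := Subtype.countable
    intro a b hab
    simp only [Function.onFun, biUnion_eq_iUnion]
    rw [Set.smul_set_iUnion, Set.smul_set_iUnion]
    refine AEDisjoint.iUnion_left_iff.mpr fun r ↦ AEDisjoint.iUnion_right_iff.mpr fun r' ↦ ?_
    have h1 : (a • ((r : G) • s) : Set α) = ((a : G) * r) • s := by
      rw [Subgroup.smul_def, smul_smul]
    have h2 : (b • ((r' : G) • s) : Set α) = ((b : G) * r') • s := by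
      rw [Subgroup.smul_def, smul_smul]
    rw [h1, h2]
    refine hs.aedisjoint (fun heq ↦ ?_)
    -- `a r = b r'` forces `r = r'` and `a = b`
    have hrr : (r : G) = r' := by
      refine huniq r r.2 r' r'.2 ?_
      have : (r' : G) * (r : G)⁻¹ = (b : G)⁻¹ * a := by
        rw [eq_inv_mul_iff_mul_eq, ← mul_assoc, ← heq, mul_assoc, mul_inv_cancel, mul_one]
      rw [this]
      exact H.mul_mem (H.inv_mem b.2) a.2
    apply hab
    rw [hrr] at heq
    exact Subtype.ext (mul_right_cancel heq)

/-- **Unfolding over coset representatives**: for `f` integrable on `F_H = ⋃_{r∈R} r • s`,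
`∫_{F_H} f = ∑_{r ∈ R} ∫_s f(r • x)` (the pieces are a.e. disjoint and `μ` is invariant).
[folklore] -/
theorem setIntegral_iUnion_smul_eq_tsum [NormedAddCommGroup E] [NormedSpace ℝ E]
    (hs : IsFundamentalDomain G s μ) (R : Set G) {f : α → E} (hf : IntegrableOn f (⋃ r ∈ R, r • s) μ) :
    ∫ x in ⋃ r ∈ R, r • s, f x ∂μ = ∑' r : R, ∫ x in s, f ((r : G) • x) ∂μ := by
  haveI : Countable R := Subtype.countable
  rw [biUnion_eq_iUnion] at hf ⊢
  have hdis : Pairwise (AEDisjoint μ on fun r : R ↦ (r : G) • s) := by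
    intro r r' hrr
    exact hs.aedisjoint (fun h ↦ hrr (Subtype.ext h))
  rw [integral_iUnion_ae (fun r ↦ hs.nullMeasurableSet.smul _) hdis hf]
  refine tsum_congr fun r ↦ ?_
  -- `∫_{r • s} f = ∫_s f (r • x)` by invariance
  have hmp := measurePreserving_smul (r : G) μ
  rw [← hmp.setIntegral_image_emb (measurableEmbedding_const_smul (r : G)) f s, Set.image_smul]

end Cosets

end Literature.NumberTheory.EllipticCurves.ModularForms
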